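import Literature.RepresentationTheory.CompactGroups.CharacterProjection
import HarnessLib

/-!
# The character projector of a compact group on an EIGENVECTOR: `P_κ v = v` if `v` transforms by `κ`, `P_κ v = 0` if it
# transforms by another continuous unitary character (Bröcker–tom Dieck III (5.10) at the one-dimensional types) — theorems only

Topic `RepresentationTheory/CompactGroups`; namespace `Literature.RepresentationTheory.CompactGroups.Schur` (that of ★ `charProj`).
Brick (Gβ2-ii-γ-core) of line LD1's organ (Gβ) «theta slice» (cell hodgecm-mathlib, seat LD1-p02 (g3); `--supports stmt-HodgeConjecture-24832`):
the torus-type projector `Schur.charProjL κ` applied to a torus EIGENCLASS (★ `F0LD2ThetaTorusEigenclass.rightRegular_toLp_lineThetaLift_follandHermite_of_eq_adelicSingle`)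
is the class itself or zero.  Over ★ `Schur.charProj_apply_of_comm` ∕ ★ `Schur.charProj_apply_of_comm_eq_zero` with the `G`-map `z ↦ z • v`.
[cite: BrockerTomDieck1985, III (5.10)]
-/

set_option autoImplicit false

noncomputable section

open MeasureTheory Complex
open scoped InnerProductSpace

namespace Literature.RepresentationTheory.CompactGroups.Schur

variable {G : Type*} [Group G] [TopologicalSpace G] [IsTopologicalGroup G] [MeasurableSpace G] [BorelSpace G] [CompactSpace G]
variable (μ : Measure G) [IsProbabilityMeasure μ] [μ.IsMulLeftInvariant]
variable {H : Type*} [NormedAddCommGroup H] [InnerProductSpace ℂ H] [CompleteSpace H]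
variable {U : ContRepresentation ℂ G H}

/-- **`P_κ v = v` for a `κ`-eigenvector**: if `κ` is a one-dimensional continuous unitary representation of the compact group `G` on `ℂ`
and `U g v = (κ g 1) • v` for all `g`, then the character projector of type `κ` fixes `v` (★ `charProj_apply_of_comm` for the `G`-map
`z ↦ z • v : ℂ → H`). [cite: BrockerTomDieck1985, III (5.10)] -/
theorem charProj_apply_of_forall_apply_eq_smul {κ : ContRepresentation ℂ G ℂ} (hκ : Continuous (κ : G → ℂ →L[ℂ] ℂ))
    [κ.toRepresentation.IsIrreducible] (hκu : ∀ (g : G) (z w : ℂ), ⟪κ g z, κ g w⟫_ℂ = ⟪z, w⟫_ℂ)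
    (v : H) (hv : ∀ g : G, U g v = (κ g 1) • v) :
    charProj μ κ U v = v := by
  -- the `G`-map `T z = z • v : ℂ → H`
  have hT : ∀ g : G, (U g).comp (ContinuousLinearMap.toSpanSingleton ℂ v) =
      (ContinuousLinearMap.toSpanSingleton ℂ v).comp (κ g) := fun g => by
    refine ContinuousLinearMap.ext_ring ?_
    simp only [ContinuousLinearMap.comp_apply, ContinuousLinearMap.toSpanSingleton_apply, one_smul, hv g]
  have h := charProj_apply_of_comm μ hκ hκu (ContinuousLinearMap.toSpanSingleton ℂ v) hT 1
  simpa only [ContinuousLinearMap.toSpanSingleton_apply, one_smul] using h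

/-- **`P_κ v = 0` for an eigenvector of ANOTHER type**: if `κ, σ` are one-dimensional continuous representations on `ℂ`, `κ` unitary,
NOT equivalent, and `U g v = (σ g 1) • v` for all `g`, then the projector of type `κ` kills `v` (★ `charProj_apply_of_comm_eq_zero`).
[cite: BrockerTomDieck1985, III (5.10); II (4.6)] -/
theorem charProj_apply_eq_zero_of_forall_apply_eq_smul {κ σ : ContRepresentation ℂ G ℂ} (hκ : Continuous (κ : G → ℂ →L[ℂ] ℂ))
    (hσ : Continuous (σ : G → ℂ →L[ℂ] ℂ)) [κ.toRepresentation.IsIrreducible] [σ.toRepresentation.IsIrreducible]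
    (hne : IsEmpty (κ.toRepresentation.Equiv σ.toRepresentation))
    (hκu : ∀ (g : G) (z w : ℂ), ⟪κ g z, κ g w⟫_ℂ = ⟪z, w⟫_ℂ)
    (v : H) (hv : ∀ g : G, U g v = (σ g 1) • v) :
    charProj μ κ U v = 0 := by
  have hS : ∀ g : G, (U g).comp (ContinuousLinearMap.toSpanSingleton ℂ v) =
      (ContinuousLinearMap.toSpanSingleton ℂ v).comp (σ g) := fun g => by
    refine ContinuousLinearMap.ext_ring ?_
    simp only [ContinuousLinearMap.comp_apply, ContinuousLinearMap.toSpanSingleton_apply, one_smul, hv g]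
  have h := charProj_apply_of_comm_eq_zero μ hκ hσ hne hκu (ContinuousLinearMap.toSpanSingleton ℂ v) hS 1
  simpa only [ContinuousLinearMap.toSpanSingleton_apply, one_smul] using h

end Literature.RepresentationTheory.CompactGroups.Schur

end
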